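import Literature.NumberTheory.GaloisRepresentations.UnramifiedLang
import Literature.NumberTheory.GaloisRepresentations.PadicAlgebraIntegral
import Mathlib.NumberTheory.Padics.RingHoms
import HarnessLib

/-!
# The period matrix of an unramified `p`-adic representation over `𝒪̂_{F_nr}`

Let `F` be a non-archimedean local field with a `ℚ_p`-algebra structure (automatically the
canonical one, file `PadicAlgebraIntegral`), `𝒪̂_{F_nr} = maxUnramifiedCompletion F` with its
Galois action `galAut`, and `r : Gal(F̄/F) →ₜ* GL_N(ℤ_p)` a continuous **unramified** representation
(trivial on the inertia group `I_F`).  Mapping `ℤ_p → 𝒪_F → 𝒪̂_{F_nr}` (`padicIntToCompletion`) we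
view `r σ` as an invertible matrix `R σ` over `𝒪̂_{F_nr}`.  The main result:

* `exists_isUnit_forall_eq_mul_galAut` — **there is an invertible `X ∈ M_N(𝒪̂_{F_nr})` with
  `X = R(σ) · σ(X)` for every `σ ∈ Gal(F̄/F)`**; i.e. the columns of `X` are a basis of
  `Γ_F`-invariant vectors of `𝒪̂_{F_nr}^N` for the semilinear action `w ↦ R(σ) σ(w)`:
  **unramified representations are `F̂_nr`-admissible** at the level of matrices
  (Fontaine 1990, A1.2.6; Fontaine–Ouyang Thm. 2.13 / Prop. 2.14; Serre, *Local Fields*, XIII §5).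

Proof: Lang's theorem over `𝒪̂_{F_nr}` (`IsAbsArithFrob.exists_isUnit_eq_mul_galAut`) gives `X`
with `X = R(σ₀) σ₀(X)` for an arithmetic Frobenius `σ₀`; for general `σ` and each level `m`,
approximate `X` modulo `𝔪̂ᵐ` by a matrix over `𝒪_{F_nr} ⊆ F_nr` and use that `σ` agrees with some
`σ₀ᵃ` on its (finitely many) entries while `(σ₀ᵃ)⁻¹ σ` lies in the open kernel of `r mod pᵐ`
(`LocalFrobeniusDensity.exists_forall_smul_eq_pow_and_mem`); so `R(σ) σ(X) ≡ X (mod 𝔪̂ᵐ)` for all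
`m`, whence equality.

Definitions: `padicIntToInteger`, `padicIntToCompletion` (the maps `ℤ_p → 𝒪_F → 𝒪̂_{F_nr}`).
No named facts.

## References

* J.-M. Fontaine, *Représentations p-adiques des corps locaux I* (1990), A1.2.6.
* [SerreLocalFields1979] J.-P. Serre, *Local Fields*, GTM 67, Ch. XIII §5.
-/

noncomputable section

open ValuativeRel Field IsLocalRing Matrix
open scoped Pointwise MatrixGroups

namespace Literature.NumberTheory.GaloisRepresentations
namespace IsNonarchimedeanLocalField

universe u

variable (F : Type u) [Field F] [ValuativeRel F] [TopologicalSpace F] [IsNonarchimedeanLocalField F]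
  (p : ℕ) [Fact p.Prime] [Algebra ℚ_[p] F]

/-! ### `ℤ_p → 𝒪_F → 𝒪̂_{F_nr}` -/

/-- The map `ℤ_p → 𝒪_F` (any `ℚ_p`-algebra structure on a local field maps `ℤ_p` into `𝒪_F`,
`LocalField.valuation_algebraMap_padicInt_le_one`). [folklore] -/
def padicIntToInteger : ℤ_[p] →+* 𝒪[F] :=
  ((algebraMap ℚ_[p] F).comp (PadicInt.Coe.ringHom (p := p))).codRestrict 𝒪[F]
    fun x => (Valuation.mem_integer_iff _ _).2 (LocalField.valuation_algebraMap_padicInt_le_one (K := F) x)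

/-- Unfolding lemma for `padicIntToInteger`. [folklore] -/
@[simp] theorem coe_padicIntToInteger (x : ℤ_[p]) :
    ((padicIntToInteger F p x : 𝒪[F]) : F) = algebraMap ℚ_[p] F (x : ℚ_[p]) := rfl

/-- The map `ℤ_p → 𝒪̂_{F_nr}`. [folklore] -/
def padicIntToCompletion : ℤ_[p] →+* maxUnramifiedCompletion F :=
  (algebraMap 𝒪[F] (maxUnramifiedCompletion F)).comp (padicIntToInteger F p)

variable {F p}

/-- The Galois action fixes the image of `ℤ_p`. [folklore] -/
@[simp] theorem galAut_padicIntToCompletion (σ : absoluteGaloisGroup F) (x : ℤ_[p]) :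
    maxUnramifiedCompletion.galAut F σ (padicIntToCompletion F p x) = padicIntToCompletion F p x :=
  maxUnramifiedCompletion.galAut_algebraMap σ _

/-- The Galois action fixes matrices with entries in the image of `ℤ_p`. [folklore] -/
theorem mapMatrix_galAut_mapMatrix_padicIntToCompletion (σ : absoluteGaloisGroup F) {N : ℕ}
    (A : Matrix (Fin N) (Fin N) ℤ_[p]) :
    (maxUnramifiedCompletion.galAut F σ).toRingHom.mapMatrix ((padicIntToCompletion F p).mapMatrix A) =
      (padicIntToCompletion F p).mapMatrix A := by
  ext i j
  simp only [RingHom.mapMatrix_apply, Matrix.map_apply, RingEquiv.toRingHom_eq_coe, RingEquiv.coe_toRingHom,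
    galAut_padicIntToCompletion]

/-- `p ∈ 𝔪̂`: the residue characteristic of `F` is `p` (`LocalField.valuation_natCast_lt_one_of_algebra`).
[folklore] -/
theorem padicIntToCompletion_natCast_mem_maximalIdeal :
    padicIntToCompletion F p p ∈ maximalIdeal (maxUnramifiedCompletion F) := by
  have h3 : ((padicIntToInteger F p p : 𝒪[F]) : F) = (p : F) := by
    rw [coe_padicIntToInteger, PadicInt.coe_natCast, map_natCast]
  have h : padicIntToInteger F p p ∈ 𝓂[F] ^ 1 := by
    rw [pow_one, IsLocalRing.mem_maximalIdeal, mem_nonunits_iff, Valuation.Integer.not_isUnit_iff_valuation_lt_one,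
      h3]
    exact LocalField.valuation_natCast_lt_one_of_algebra (K := F) (p := p)
  have h' := (maxUnramifiedCompletion.algebraMap_mem_maximalIdeal_pow_iff (F := F) 1 (padicIntToInteger F p p)).2 h
  rwa [pow_one] at h'

/-! ### Entrywise congruences of matrices -/

section Cong

variable {R : Type*} [CommRing R] {N : ℕ}

/-- `A ≡ B` entrywise modulo the ideal `J`. [folklore] -/
def MatCong (J : Ideal R) (A B : Matrix (Fin N) (Fin N) R) : Prop := ∀ i j, A i j - B i j ∈ J

/-- Congruence is reflexive. [folklore] -/
theorem MatCong.refl (J : Ideal R) (A : Matrix (Fin N) (Fin N) R) : MatCong J A A :=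
  fun i j => by rw [sub_self]; exact zero_mem _

/-- Congruence is symmetric. [folklore] -/
theorem MatCong.symm {J : Ideal R} {A B : Matrix (Fin N) (Fin N) R} (h : MatCong J A B) : MatCong J B A :=
  fun i j => by rw [← neg_sub]; exact neg_mem (h i j)

/-- Congruence is transitive. [folklore] -/
theorem MatCong.trans {J : Ideal R} {A B C : Matrix (Fin N) (Fin N) R} (h₁ : MatCong J A B) (h₂ : MatCong J B C) :
    MatCong J A C :=
  fun i j => by
    have : A i j - C i j = (A i j - B i j) + (B i j - C i j) := by ring
    rw [this]; exact add_mem (h₁ i j) (h₂ i j)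

/-- Congruence is preserved by left multiplication. [folklore] -/
theorem MatCong.mul_left {J : Ideal R} {A B : Matrix (Fin N) (Fin N) R} (h : MatCong J A B)
    (C : Matrix (Fin N) (Fin N) R) : MatCong J (C * A) (C * B) := fun i j => by
  rw [Matrix.mul_apply, Matrix.mul_apply, ← Finset.sum_sub_distrib]
  refine Submodule.sum_mem _ fun l _ => ?_
  rw [← mul_sub]
  exact Ideal.mul_mem_left _ _ (h l j)

/-- Congruence is preserved by right multiplication. [folklore] -/
theorem MatCong.mul_right {J : Ideal R} {A B : Matrix (Fin N) (Fin N) R} (h : MatCong J A B)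
    (C : Matrix (Fin N) (Fin N) R) : MatCong J (A * C) (B * C) := fun i j => by
  rw [Matrix.mul_apply, Matrix.mul_apply, ← Finset.sum_sub_distrib]
  refine Submodule.sum_mem _ fun l _ => ?_
  rw [← sub_mul]
  exact Ideal.mul_mem_right _ _ (h i l)

/-- `A ≡ B (mod J)` and `A = B + D` with `D ≡ 0`. [folklore] -/
theorem MatCong.of_sub_mem {J : Ideal R} {A B : Matrix (Fin N) (Fin N) R} (h : ∀ i j, (A - B) i j ∈ J) :
    MatCong J A B := fun i j => by simpa only [Matrix.sub_apply] using h i j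

/-- Matrices congruent modulo every power of `I` are equal when `R` is `I`-adically separated.
[folklore] -/
theorem MatCong.eq_of_forall_pow {I : Ideal R} [IsHausdorff I R] {A B : Matrix (Fin N) (Fin N) R}
    (h : ∀ m : ℕ, MatCong (I ^ m) A B) : A = B := by
  ext i j
  rw [← sub_eq_zero]
  refine IsHausdorff.haus' (I := I) _ fun m => ?_
  rw [SModEq.zero, smul_eq_mul, Ideal.mul_top]
  exact h m i j

/-- A ring map sending `J` into `J` preserves congruences. [folklore] -/
theorem MatCong.map {J : Ideal R} {A B : Matrix (Fin N) (Fin N) R} (h : MatCong J A B) (f : R →+* R)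
    (hf : ∀ x ∈ J, f x ∈ J) : MatCong J (f.mapMatrix A) (f.mapMatrix B) := fun i j => by
  simp only [RingHom.mapMatrix_apply, Matrix.map_apply, ← map_sub]
  exact hf _ (h i j)

end Cong

/-! ### The period matrix -/

variable {N : ℕ}

/-- `galAut σ` maps `𝔪̂ ^ m` into itself (`𝔪̂ = (ϖ_F)` and `σ` fixes `ϖ_F`). [folklore] -/
theorem maxUnramifiedCompletion.galAut_mem_maximalIdeal_pow (σ : absoluteGaloisGroup F) (m : ℕ)
    {x : maxUnramifiedCompletion F} (hx : x ∈ maximalIdeal (maxUnramifiedCompletion F) ^ m) :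
    maxUnramifiedCompletion.galAut F σ x ∈ maximalIdeal (maxUnramifiedCompletion F) ^ m := by
  obtain ⟨ϖ, hϖ⟩ := IsDiscreteValuationRing.exists_irreducible 𝒪[F]
  rw [maxUnramifiedCompletion.maximalIdeal_eq_span_uniformizer hϖ, Ideal.span_singleton_pow,
    Ideal.mem_span_singleton] at hx ⊢
  obtain ⟨y, rfl⟩ := hx
  rw [map_mul, map_pow, maxUnramifiedCompletion.galAut_algebraMap]
  exact dvd_mul_right _ _

/-- Matrices over `𝒪_{F_nr}` pushed to `𝒪̂_{F_nr}`: `σ` acts through the action on `𝒪_{F_nr}`. [folklore] -/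
theorem mapMatrix_galAut_mapMatrix_algebraMap (σ : absoluteGaloisGroup F) (A : Matrix (Fin N) (Fin N) (maxUnramifiedIntegers F)) :
    (maxUnramifiedCompletion.galAut F σ).toRingHom.mapMatrix
        ((algebraMap (maxUnramifiedIntegers F) (maxUnramifiedCompletion F)).mapMatrix A) =
      (algebraMap (maxUnramifiedIntegers F) (maxUnramifiedCompletion F)).mapMatrix
        ((MulSemiringAction.toRingHom _ (maxUnramifiedIntegers F) σ).mapMatrix A) := by
  ext i j
  simp only [RingHom.mapMatrix_apply, Matrix.map_apply, RingEquiv.toRingHom_eq_coe, RingEquiv.coe_toRingHom,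
    maxUnramifiedCompletion.galAut_algebraMap', MulSemiringAction.toRingHom_apply]

/-- The Galois action on matrices over `𝒪̂_{F_nr}` (entrywise). [folklore] -/
abbrev maxUnramifiedCompletion.galAutMatrix (τ : absoluteGaloisGroup F) :
    Matrix (Fin N) (Fin N) (maxUnramifiedCompletion F) →+* Matrix (Fin N) (Fin N) (maxUnramifiedCompletion F) :=
  (maxUnramifiedCompletion.galAut F τ).toRingHom.mapMatrix

/-- Unfolding lemma for `galAutMatrix`. [folklore] -/
theorem maxUnramifiedCompletion.galAutMatrix_apply (τ : absoluteGaloisGroup F)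
    (Y : Matrix (Fin N) (Fin N) (maxUnramifiedCompletion F)) (i j : Fin N) :
    maxUnramifiedCompletion.galAutMatrix τ Y i j = maxUnramifiedCompletion.galAut F τ (Y i j) := rfl

/-- `galAutMatrix` is multiplicative in the group element. [folklore] -/
theorem maxUnramifiedCompletion.galAutMatrix_mul (τ τ' : absoluteGaloisGroup F)
    (Y : Matrix (Fin N) (Fin N) (maxUnramifiedCompletion F)) :
    maxUnramifiedCompletion.galAutMatrix (τ * τ') Y =
      maxUnramifiedCompletion.galAutMatrix τ (maxUnramifiedCompletion.galAutMatrix τ' Y) :=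
  Matrix.ext fun i j => by
    simp only [maxUnramifiedCompletion.galAutMatrix_apply, map_mul, RingAut.mul_apply]

/-- `galAutMatrix 1 = id`. [folklore] -/
theorem maxUnramifiedCompletion.galAutMatrix_one (Y : Matrix (Fin N) (Fin N) (maxUnramifiedCompletion F)) :
    maxUnramifiedCompletion.galAutMatrix (1 : absoluteGaloisGroup F) Y = Y :=
  Matrix.ext fun i j => by
    simp only [maxUnramifiedCompletion.galAutMatrix_apply, map_one, RingAut.one_apply]

variable (r : absoluteGaloisGroup F →ₜ* GL (Fin N) ℤ_[p])

/-- The matrix `R(σ) ∈ M_N(𝒪̂_{F_nr})` of `r σ`. [folklore] -/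
abbrev periodCoeff (σ : absoluteGaloisGroup F) : Matrix (Fin N) (Fin N) (maxUnramifiedCompletion F) :=
  (padicIntToCompletion F p).mapMatrix ((r σ : GL (Fin N) ℤ_[p]) : Matrix (Fin N) (Fin N) ℤ_[p])

/-- `R(σ)` is invertible. [folklore] -/
theorem isUnit_periodCoeff (σ : absoluteGaloisGroup F) : IsUnit (periodCoeff (p := p) r σ) :=
  ((r σ).isUnit).map (padicIntToCompletion F p).mapMatrix

/-- `R(σ τ) = R(σ) R(τ)`. [folklore] -/
theorem periodCoeff_mul (σ τ : absoluteGaloisGroup F) :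
    periodCoeff (p := p) r (σ * τ) = periodCoeff (p := p) r σ * periodCoeff (p := p) r τ := by
  rw [periodCoeff, map_mul, Units.val_mul, map_mul]

/-- `R(1) = 1`. [folklore] -/
theorem periodCoeff_one : periodCoeff (p := p) r 1 = 1 := by
  rw [periodCoeff, map_one, Units.val_one, map_one]

/-- `R(σ ^ a) = R(σ) ^ a`. [folklore] -/
theorem periodCoeff_pow (σ : absoluteGaloisGroup F) (a : ℕ) :
    periodCoeff (p := p) r (σ ^ a) = periodCoeff (p := p) r σ ^ a := by
  induction a with
  | zero => rw [pow_zero, pow_zero, periodCoeff_one]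
  | succ a ih => rw [pow_succ, periodCoeff_mul, ih, pow_succ]

/-- `τ(R(σ)) = R(σ)`. [folklore] -/
theorem galAutMatrix_periodCoeff (τ σ : absoluteGaloisGroup F) :
    maxUnramifiedCompletion.galAutMatrix τ (periodCoeff (p := p) r σ) = periodCoeff (p := p) r σ :=
  mapMatrix_galAut_mapMatrix_padicIntToCompletion τ _

/-- If `r τ ≡ 1 (mod p ^ m)` then `R(τ) ≡ 1 (mod 𝔪̂ ^ m)`. [folklore] -/
theorem matCong_periodCoeff_one {m : ℕ} {τ : absoluteGaloisGroup F}
    (hτ : ∀ i j, ((r τ : GL (Fin N) ℤ_[p]) : Matrix (Fin N) (Fin N) ℤ_[p]) i j - (1 : Matrix (Fin N) (Fin N) ℤ_[p]) i j ∈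
      Ideal.span {(p : ℤ_[p]) ^ m}) :
    MatCong (maximalIdeal (maxUnramifiedCompletion F) ^ m) (periodCoeff (p := p) r τ) 1 := by
  intro i j
  obtain ⟨z, hz⟩ := Ideal.mem_span_singleton'.1 (hτ i j)
  have : periodCoeff (p := p) r τ i j - (1 : Matrix (Fin N) (Fin N) (maxUnramifiedCompletion F)) i j =
      padicIntToCompletion F p (((r τ : GL (Fin N) ℤ_[p]) : Matrix (Fin N) (Fin N) ℤ_[p]) i j -
        (1 : Matrix (Fin N) (Fin N) ℤ_[p]) i j) := by
    simp only [RingHom.mapMatrix_apply, Matrix.map_apply, map_sub, Matrix.one_apply]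
    split_ifs <;> simp
  rw [this, ← hz, map_mul, map_pow]
  exact Ideal.mul_mem_left _ _ (Ideal.pow_mem_pow padicIntToCompletion_natCast_mem_maximalIdeal m)

omit [ValuativeRel F] [TopologicalSpace F] [IsNonarchimedeanLocalField F] [Algebra ℚ_[p] F] in
/-- The congruence subgroup `{τ | r τ ≡ 1 (mod p ^ m)}` pulled back to `Gal(F̄/F)` is open. [folklore] -/
theorem isOpen_setOf_congr (m : ℕ) :
    IsOpen {τ : absoluteGaloisGroup F | ∀ i j,
      ((r τ : GL (Fin N) ℤ_[p]) : Matrix (Fin N) (Fin N) ℤ_[p]) i j - (1 : Matrix (Fin N) (Fin N) ℤ_[p]) i j ∈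
        Ideal.span {(p : ℤ_[p]) ^ m}} := by
  simp only [Set.setOf_forall]
  refine isOpen_iInter_of_finite fun i => isOpen_iInter_of_finite fun j => ?_
  have hcont : Continuous fun τ : absoluteGaloisGroup F =>
      ((r τ : GL (Fin N) ℤ_[p]) : Matrix (Fin N) (Fin N) ℤ_[p]) i j - (1 : Matrix (Fin N) (Fin N) ℤ_[p]) i j :=
    ((Units.continuous_val.comp r.continuous_toFun).matrix_elem i j).sub continuous_const
  have hopen : IsOpen ((Ideal.span {(p : ℤ_[p]) ^ m} : Ideal ℤ_[p]) : Set ℤ_[p]) := by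
    have : ((Ideal.span {(p : ℤ_[p]) ^ m} : Ideal ℤ_[p]) : Set ℤ_[p]) = Metric.closedBall 0 ((p : ℝ) ^ (-(m : ℤ))) := by
      ext z
      rw [SetLike.mem_coe, ← PadicInt.norm_le_pow_iff_mem_span_pow, Metric.mem_closedBall, dist_zero_right]
    rw [this]
    exact IsUltrametricDist.isOpen_closedBall _ (zpow_ne_zero _ (Nat.cast_ne_zero.2 (Fact.out : p.Prime).ne_zero))
  exact hopen.preimage hcont

/-- Iterating the Frobenius relation: if `X = R(σ₀) σ₀(X)` and `u = R(σ₀)` then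
`σ₀ᵃ(X) = u⁻ᵃ X`. [folklore] -/
theorem galAutMatrix_pow_eq_of_eq {σ₀ : absoluteGaloisGroup F} {X : Matrix (Fin N) (Fin N) (maxUnramifiedCompletion F)}
    {u : (Matrix (Fin N) (Fin N) (maxUnramifiedCompletion F))ˣ} (hu : (u : Matrix (Fin N) (Fin N) _) = periodCoeff (p := p) r σ₀)
    (hX : X = periodCoeff (p := p) r σ₀ * maxUnramifiedCompletion.galAutMatrix σ₀ X) (a : ℕ) :
    maxUnramifiedCompletion.galAutMatrix (σ₀ ^ a) X = (↑(u⁻¹ ^ a) : Matrix (Fin N) (Fin N) (maxUnramifiedCompletion F)) * X := by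
  have hφX : maxUnramifiedCompletion.galAutMatrix σ₀ X = (↑u⁻¹ : Matrix (Fin N) (Fin N) (maxUnramifiedCompletion F)) * X := by
    have h1 : (↑u⁻¹ : Matrix (Fin N) (Fin N) (maxUnramifiedCompletion F)) * X =
        (↑u⁻¹ : Matrix (Fin N) (Fin N) _) * (periodCoeff (p := p) r σ₀ * maxUnramifiedCompletion.galAutMatrix σ₀ X) := by
      rw [← hX]
    rw [h1, ← Matrix.mul_assoc, ← hu, Units.inv_mul, Matrix.one_mul]
  have hφu : ∀ τ : absoluteGaloisGroup F,
      maxUnramifiedCompletion.galAutMatrix τ ((u⁻¹ : (Matrix (Fin N) (Fin N) (maxUnramifiedCompletion F))ˣ) :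
        Matrix (Fin N) (Fin N) (maxUnramifiedCompletion F)) =
        ((u⁻¹ : (Matrix (Fin N) (Fin N) (maxUnramifiedCompletion F))ˣ) : Matrix (Fin N) (Fin N) _) := by
    intro τ
    have h1 : Units.map (maxUnramifiedCompletion.galAutMatrix (N := N) τ).toMonoidHom u = u :=
      Units.ext (by rw [Units.coe_map, hu]; exact galAutMatrix_periodCoeff r τ σ₀)
    have h2 := Units.coe_map_inv (maxUnramifiedCompletion.galAutMatrix (N := N) τ).toMonoidHom u
    rw [h1] at h2
    exact h2.symm
  induction a with
  | zero => rw [pow_zero, pow_zero, Units.val_one, Matrix.one_mul, maxUnramifiedCompletion.galAutMatrix_one]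
  | succ a ih =>
    rw [pow_succ, maxUnramifiedCompletion.galAutMatrix_mul, hφX, map_mul, hφu, ih, ← Matrix.mul_assoc,
      Units.val_pow_eq_pow_val, Units.val_pow_eq_pow_val, ← pow_succ']

/-- **The period matrix of an unramified `p`-adic representation.** For a continuous unramified
`r : Gal(F̄/F) → GL_N(ℤ_p)` there is an invertible `X ∈ M_N(𝒪̂_{F_nr})` with `X = R(σ) · σ(X)` for
every `σ ∈ Gal(F̄/F)` (`R(σ)` the image of `r σ`); equivalently the semilinear `Gal(F̄/F)`-module
`(𝒪̂_{F_nr})^N`, `w ↦ R(σ) σ(w)`, has a basis of invariant vectors: unramified representations are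
`F̂_nr`-admissible (Fontaine 1990, A1.2.6; Fontaine–Ouyang, Thm. 2.13 and Prop. 2.14; Lang's theorem
over `𝒪̂_{F_nr}` plus the density of Frobenius powers modulo inertia).
[cite: SerreLocalFields1979, Ch. XIII §5] -/
theorem exists_isUnit_forall_eq_mul_galAut (hr : ∀ σ ∈ absInertia F, r σ = 1) :
    ∃ X : Matrix (Fin N) (Fin N) (maxUnramifiedCompletion F), IsUnit X ∧
      ∀ σ : absoluteGaloisGroup F,
        X = periodCoeff (p := p) r σ * (maxUnramifiedCompletion.galAut F σ).toRingHom.mapMatrix X := by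
  classical
  obtain ⟨σ₀, hσ₀⟩ := exists_isAbsArithFrob_holds (F := F)
  obtain ⟨X, hXu, hX⟩ := IsAbsArithFrob.exists_isUnit_eq_mul_galAut hσ₀ (isUnit_periodCoeff (p := p) r σ₀)
  refine ⟨X, hXu, fun σ => ?_⟩
  change X = periodCoeff (p := p) r σ * maxUnramifiedCompletion.galAutMatrix σ X
  change X = periodCoeff (p := p) r σ₀ * maxUnramifiedCompletion.galAutMatrix σ₀ X at hX
  obtain ⟨u, hu⟩ := isUnit_periodCoeff (p := p) r σ₀
  have hφpow := galAutMatrix_pow_eq_of_eq r hu hX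
  have hGpow : ∀ a : ℕ, periodCoeff (p := p) r (σ₀ ^ a) * (↑(u⁻¹ ^ a) : Matrix (Fin N) (Fin N) _) = 1 := by
    intro a
    rw [periodCoeff_pow, ← hu, ← Units.val_pow_eq_pow_val, ← Units.val_mul, inv_pow, mul_inv_cancel, Units.val_one]
  -- congruence modulo `𝔪̂ ^ m` for every `m`
  refine MatCong.eq_of_forall_pow (I := maximalIdeal (maxUnramifiedCompletion F)) fun m => ?_
  -- approximate `X` by a matrix over `𝒪_{F_nr}`
  choose xm hxm using fun i j => maxUnramifiedCompletion.exists_sub_algebraMap_mem_pow (X i j) m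
  have hXXm : MatCong (maximalIdeal (maxUnramifiedCompletion F) ^ m) X
      ((algebraMap (maxUnramifiedIntegers F) (maxUnramifiedCompletion F)).mapMatrix (Matrix.of xm)) :=
    fun i j => by simpa using hxm i j
  -- the open set `U = {τ | r τ ≡ 1 mod p ^ m}` contains inertia; apply the density lemma
  have hIU : (absInertia F : Set (absoluteGaloisGroup F)) ⊆ {τ : absoluteGaloisGroup F | ∀ i j,
      ((r τ : GL (Fin N) ℤ_[p]) : Matrix (Fin N) (Fin N) ℤ_[p]) i j - (1 : Matrix (Fin N) (Fin N) ℤ_[p]) i j ∈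
        Ideal.span {(p : ℤ_[p]) ^ m}} := by
    intro τ hτ i j
    rw [hr τ hτ, Units.val_one, sub_self]
    exact zero_mem _
  obtain ⟨a, haT, haU⟩ := exists_forall_smul_eq_pow_and_mem hσ₀ σ
    (Finset.univ.image fun ij : Fin N × Fin N => ((xm ij.1 ij.2 : maxUnramifiedIntegers F) : AlgebraicClosure F))
    (by
      intro t ht
      obtain ⟨ij, -, rfl⟩ := Finset.mem_image.1 ht
      exact mem_maxUnramified_of_mem (xm ij.1 ij.2).2)
    (isOpen_setOf_congr r m) hIU
  -- `σ(Xm) = σ₀ ^ a (Xm)`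
  have hσXm : (MulSemiringAction.toRingHom _ (maxUnramifiedIntegers F) σ).mapMatrix (Matrix.of xm) =
      (MulSemiringAction.toRingHom _ (maxUnramifiedIntegers F) (σ₀ ^ a)).mapMatrix (Matrix.of xm) := by
    refine Matrix.ext fun i j => ?_
    simp only [RingHom.mapMatrix_apply, Matrix.map_apply, MulSemiringAction.toRingHom_apply, Matrix.of_apply]
    refine Subtype.ext ?_
    rw [maxUnramifiedIntegers.coe_smul, maxUnramifiedIntegers.coe_smul]
    exact haT _ (Finset.mem_image.2 ⟨(i, j), Finset.mem_univ _, rfl⟩)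
  -- Step 1: `σ(X) ≡ σ₀ ^ a (X)`
  have h1 : MatCong (maximalIdeal (maxUnramifiedCompletion F) ^ m) (maxUnramifiedCompletion.galAutMatrix σ X)
      (maxUnramifiedCompletion.galAutMatrix (σ₀ ^ a) X) := by
    have hmapσ := hXXm.map (maxUnramifiedCompletion.galAut F σ).toRingHom
      (fun x hx => maxUnramifiedCompletion.galAut_mem_maximalIdeal_pow σ m hx)
    have hmapσ₀ := hXXm.map (maxUnramifiedCompletion.galAut F (σ₀ ^ a)).toRingHom
      (fun x hx => maxUnramifiedCompletion.galAut_mem_maximalIdeal_pow _ m hx)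
    rw [mapMatrix_galAut_mapMatrix_algebraMap, hσXm, ← mapMatrix_galAut_mapMatrix_algebraMap] at hmapσ
    exact hmapσ.trans hmapσ₀.symm
  -- Step 2: `R((σ₀ ^ a)⁻¹ σ) ≡ 1`
  have h2 : MatCong (maximalIdeal (maxUnramifiedCompletion F) ^ m) (periodCoeff (p := p) r ((σ₀ ^ a)⁻¹ * σ)) 1 :=
    matCong_periodCoeff_one r haU
  -- combine
  have key : periodCoeff (p := p) r σ * maxUnramifiedCompletion.galAutMatrix σ X =
      periodCoeff (p := p) r (σ₀ ^ a) *
        (periodCoeff (p := p) r ((σ₀ ^ a)⁻¹ * σ) * maxUnramifiedCompletion.galAutMatrix σ X) := by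
    rw [← Matrix.mul_assoc, ← periodCoeff_mul, mul_inv_cancel_left]
  rw [key]
  have h3 : MatCong (maximalIdeal (maxUnramifiedCompletion F) ^ m)
      (periodCoeff (p := p) r ((σ₀ ^ a)⁻¹ * σ) * maxUnramifiedCompletion.galAutMatrix σ X)
      (maxUnramifiedCompletion.galAutMatrix (σ₀ ^ a) X) := by
    have h := h2.mul_right (maxUnramifiedCompletion.galAutMatrix σ X)
    rw [Matrix.one_mul] at h
    exact h.trans h1
  have h4 := h3.mul_left (periodCoeff (p := p) r (σ₀ ^ a))
  have h5 : periodCoeff (p := p) r (σ₀ ^ a) * maxUnramifiedCompletion.galAutMatrix (σ₀ ^ a) X = X := by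
    rw [hφpow, ← Matrix.mul_assoc, hGpow, Matrix.one_mul]
  rw [h5] at h4
  exact h4.symm

end IsNonarchimedeanLocalField
end Literature.NumberTheory.GaloisRepresentations

end
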